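import Summits.CriticalPhenomena.CardyFormulaZ2.Theorems.CardyComplexConeParafermionToSLESixFamiliesFlipDefs
import HarnessLib

/-!
# Stub `stub_mesoEnvelope : MesoEnvelope` of line `flip-involution-return-law` (crux `ParafermionToSLESixFamilies`,
stmt-CriticalPhenomena-11389, route `CardyComplexCone`): what the tree gives — the reduction to `UniformInnerEnvelope`

The registered stub `stub_mesoEnvelope : MesoEnvelope` (`…FlipDefs`) asks, along every discretisation family with
the crux's guards and for every `ε ∈ (0, 1/3)`, for an exponent `a < 1` and a constant `C` with, eventually in the
mesh `δ`, `‖E_δ(v,f)‖ ≤ C · δ^{1/3} · d^{-a}` at every corner `(v,f)` of depth `d = infDist(δv, Dᶜ) ≥ δ^{1/3-ε}`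
(`E_δ = cornerObs`, the spin-`1/3` corner observable of the medial exploration). This is OPEN percolation content
(the `δ^{1/3}` envelope of the corner observable in the bulk — below the two-arm scale — uniformly down to
mesoscopic depth); it is NOT vacuous: the trivial bound `‖cornerObs‖ ≤ 1` would need `C δ^{1/3} d^{-a} ≥ 1` on the
whole depth range `d ∈ [δ^{1/3-ε}, diam D]`, i.e. at `d ≍ 1` the false `δ^{1/3} ≳ 1`, and at `d = δ^{1/3-ε}` the
exponent condition `1/3 - a (1/3 - ε) ≤ 0 ⟺ a ≥ 1/(1-3ε) > 1`, excluded by `a < 1`; an RSW envelope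
`‖cornerObs‖ ≤ C (δ/d)^α` helps only if `α ≥ 1/3` (again the corners at depth `≍ 1`).

What this file proves, sorry-free: the stub FOLLOWS from the one named milestone of the companion crux
`EdgePrecompact` (stmt-CriticalPhenomena-11387) that carries exactly this content, the UNIFORM INNER ENVELOPE
`Summit.CriticalPhenomena.CardyFormulaZ2.Cruxes.EdgePrecompact.QkzStripBoundaryArm.UniformInnerEnvelope`
(`Theorems/CardyComplexConeDefs.lean`: one `C` with `‖cornerObs E E.δ v f‖ ≤ C · R^{-1/3}` at lattice depth
`R ≥ 1`, `R · δ ≤ infDist(δv, Dᶜ)`, for all admissible data of all Jordan Dobrushin domains; itself reduced in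
the tree to the open local envelope X1 by `uniformInnerEnvelope_of_localInnerEnvelopeUI`, and certified hard by
`halfPlaneArm_cubeRoot_of_uniformInnerEnvelope`). The implication holds with the Koebe exponent `a = 1/3` and the
constant `max C 0 · 2^{1/3}`: eventually `δ < 1`, so a corner of depth `d ≥ δ^{1/3-ε} ≥ δ` has lattice depth
`R = ⌊d/δ⌋ ≥ 1` with `R δ ≤ d < 2 R δ`, whence `R^{-1/3} ≤ (d/(2δ))^{-1/3} = 2^{1/3} δ^{1/3} d^{-1/3}`
(arithmetic adapted from `EdgePrecompact.QkzStripBoundaryArm.boundClause_at`).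

What does NOT follow: `MesoEnvelope` from the crux `Theses.CardyComplexCone.EdgePrecompact` itself — its clause (i)
bounds `‖E_δ‖ ≤ C_K δ^{1/3}` on each FIXED compact `K ⊂ D` with a `K`-dependent constant and a `K`-dependent
eventual range in `δ`, which says nothing at depth `δ^{1/3-ε} → 0`.
-/

noncomputable section

open scoped Topology NNReal ENNReal BigOperators Classical
open Filter Set MeasureTheory Metric
open Literature.Probability Literature.Probability.LatticeModels Literature.Probability.Percolation
open Literature.Probability.RandomPlanarGeometry
open Summit.CriticalPhenomena.CardyFormulaZ2.Cruxes.ParafermionToSLESixFamilies.IicTraceFluxPairing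
open Summit.CriticalPhenomena.CardyFormulaZ2.Cruxes.EdgePrecompact.QkzStripBoundaryArm (cornerObs)

namespace Summit.CriticalPhenomena.CardyFormulaZ2.Cruxes.ParafermionToSLESixFamilies.FlipInvolutionReturnLaw

/-- The lattice-depth arithmetic: for `0 < δ` and `δ ≤ d`, the integer depth `R = ⌊d/δ⌋₊` satisfies `1 ≤ R`,
`R δ ≤ d` and `d/(2δ) ≤ R`. -/
theorem floor_depth_bounds {δ d : ℝ} (hδ0 : 0 < δ) (hδd : δ ≤ d) :
    1 ≤ ⌊d / δ⌋₊ ∧ (⌊d / δ⌋₊ : ℝ) * δ ≤ d ∧ d / (2 * δ) ≤ (⌊d / δ⌋₊ : ℝ) := by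
  -- adapted from EdgePrecompact.QkzStripBoundaryArm.boundClause_at
  have hdδ : 1 ≤ d / δ := by rwa [le_div_iff₀ hδ0, one_mul]
  have hR1 : 1 ≤ ⌊d / δ⌋₊ := Nat.floor_pos.2 hdδ
  refine ⟨hR1, ?_, ?_⟩
  · have : (⌊d / δ⌋₊ : ℝ) ≤ d / δ := Nat.floor_le (by positivity)
    rwa [le_div_iff₀ hδ0] at this
  · have hlt : d / δ < (⌊d / δ⌋₊ : ℝ) + 1 := Nat.lt_floor_add_one _
    have hhalf : d / δ = 2 * (d / (2 * δ)) := by field_simp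
    have hR1' : (1:ℝ) ≤ (⌊d / δ⌋₊ : ℝ) := by exact_mod_cast hR1
    linarith

/-- The rescaling identity behind the Koebe exponent: `(d/(2δ))^{-1/3} = 2^{1/3} · δ^{1/3} · d^{-1/3}` for
`δ, d > 0`. -/
theorem rpow_depth_rescale {δ d : ℝ} (hδ0 : 0 < δ) (hd : 0 < d) :
    (d / (2 * δ)) ^ (-(1:ℝ) / 3) = (2:ℝ) ^ ((1:ℝ) / 3) * δ ^ ((1:ℝ) / 3) * d ^ (-((1:ℝ) / 3)) := by
  have hx : 0 < d / (2 * δ) := by positivity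
  have hdpow : 0 < d ^ ((1:ℝ) / 3) := Real.rpow_pos_of_pos hd _
  calc (d / (2 * δ)) ^ (-(1:ℝ) / 3) = ((d / (2 * δ)) ^ ((1:ℝ) / 3))⁻¹ := by
          rw [show (-(1:ℝ) / 3) = -((1:ℝ) / 3) by ring, Real.rpow_neg hx.le]
    _ = ((d / (2 * δ))⁻¹) ^ ((1:ℝ) / 3) := (Real.inv_rpow hx.le _).symm
    _ = ((2 * δ) * d⁻¹) ^ ((1:ℝ) / 3) := by rw [inv_div, div_eq_mul_inv]
    _ = (2:ℝ) ^ ((1:ℝ) / 3) * δ ^ ((1:ℝ) / 3) * (d⁻¹) ^ ((1:ℝ) / 3) := by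
          rw [Real.mul_rpow (by positivity) (inv_nonneg.2 hd.le), Real.mul_rpow (by norm_num) hδ0.le]
    _ = (2:ℝ) ^ ((1:ℝ) / 3) * δ ^ ((1:ℝ) / 3) * d ^ (-((1:ℝ) / 3)) := by
          rw [Real.inv_rpow hd.le, Real.rpow_neg hd.le]

/-- **`UniformInnerEnvelope ⇒ MesoEnvelope`** (the registered helper of stub `stub_mesoEnvelope`): the uniform inner
envelope of the companion crux `EdgePrecompact` — one `C` with `‖cornerObs E E.δ v f‖ ≤ C R^{-1/3}` at lattice depth
`R ≥ 1` for all admissible data of all Jordan Dobrushin domains — gives the mesoscopic envelope of this line with the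
Koebe exponent `a = 1/3 < 1` and the constant `max C 0 · 2^{1/3}`, for every `ε ∈ (0, 1/3)`: eventually `δ ∈ (0,1)`
and `Λ δ` is admissible; a corner of depth `d ≥ δ^{1/3-ε} ≥ δ` has lattice depth `R = ⌊d/δ⌋ ≥ 1`, `Rδ ≤ d < 2Rδ`, so
`‖E_δ(v,f)‖ ≤ C R^{-1/3} ≤ max C 0 · (d/(2δ))^{-1/3} = max C 0 · 2^{1/3} · δ^{1/3} · d^{-1/3}`. -/
theorem mesoEnvelope_of_uniformInnerEnvelope : Summit.CriticalPhenomena.CardyFormulaZ2.Cruxes.EdgePrecompact.QkzStripBoundaryArm.UniformInnerEnvelope → MesoEnvelope := by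
  rintro ⟨C, hC⟩ D Λ hΩ hδ hadm ε hε hε3
  refine ⟨(1:ℝ) / 3, by norm_num, max C 0 * (2:ℝ) ^ ((1:ℝ) / 3), ?_⟩
  have hsmall : ∀ᶠ δ in 𝓝[>] (0:ℝ), δ ∈ Ioo (0:ℝ) 1 := Ioo_mem_nhdsGT one_pos
  filter_upwards [hadm, hsmall] with δ hδadm hδI
  obtain ⟨hδ0, hδ1⟩ := hδI
  intro v f hvf _hvD hdepth
  -- the depth `d ≥ δ^{1/3-ε} ≥ δ`
  set d : ℝ := infDist (meshPoint δ v) D.carrierᶜ with hd_def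
  have hδd : δ ≤ d :=
    calc δ = δ ^ (1:ℝ) := (Real.rpow_one δ).symm
      _ ≤ δ ^ ((1:ℝ) / 3 - ε) := Real.rpow_le_rpow_of_exponent_ge hδ0 hδ1.le (by linarith)
      _ ≤ d := hdepth
  have hdpos : 0 < d := lt_of_lt_of_le hδ0 hδd
  -- the lattice depth `R = ⌊d/δ⌋`
  obtain ⟨hR1, hRle, hRge⟩ := floor_depth_bounds hδ0 hδd
  set R : ℕ := ⌊d / δ⌋₊ with hR_def
  -- the envelope at depth `R`
  have hE : (Λ δ).δ = δ := hδ δ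
  have h := hC D (Λ δ) (hΩ δ) hδadm v f hvf R hR1 (by rw [hE]; exact hRle)
  rw [hE] at h
  -- `R^{-1/3} ≤ (d/(2δ))^{-1/3} = 2^{1/3} δ^{1/3} d^{-1/3}`
  have hx : 0 < d / (2 * δ) := by positivity
  have hmono : (R : ℝ) ^ (-(1:ℝ) / 3) ≤ (d / (2 * δ)) ^ (-(1:ℝ) / 3) :=
    Real.rpow_le_rpow_of_nonpos hx hRge (by norm_num)
  have hr0 : 0 ≤ (R : ℝ) ^ (-(1:ℝ) / 3) := Real.rpow_nonneg (by positivity) _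
  calc ‖cornerObs (Λ δ) δ v f‖ ≤ C * (R : ℝ) ^ (-(1:ℝ) / 3) := h
    _ ≤ max C 0 * (R : ℝ) ^ (-(1:ℝ) / 3) := mul_le_mul_of_nonneg_right (le_max_left _ _) hr0
    _ ≤ max C 0 * (d / (2 * δ)) ^ (-(1:ℝ) / 3) := mul_le_mul_of_nonneg_left hmono (le_max_right _ _)
    _ = max C 0 * (2:ℝ) ^ ((1:ℝ) / 3) * δ ^ ((1:ℝ) / 3) * d ^ (-((1:ℝ) / 3)) := by
          rw [rpow_depth_rescale hδ0 hdpos]; ring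

end Summit.CriticalPhenomena.CardyFormulaZ2.Cruxes.ParafermionToSLESixFamilies.FlipInvolutionReturnLaw

end
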